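import Summits.NavierStokesRegularity.NavierStokesRegularity.Theorems.ExtremiserTransienceLocalMaximiserLimitDefs
import Literature.Analysis.FluidPDE.NSVorticityBKMProofs
import Literature.Analysis.FluidPDE.ElgindiBlowup
import Literature.Analysis.FluidPDE.EnstrophyGronwall
import Literature.Analysis.FluidPDE.CKNInterpolationEstimate
import Literature.Analysis.FluidPDE.VorticityCalculus
import Literature.Analysis.Calculus.DerivativeInterpolation
import HarnessLib

/-!
# Route `ExtremiserTransience`, crux `NearExtremalTransiencePerFlow` (stmt-NavierStokesRegularity-26567) —
# LINE g9-1 «local maximiser» (ns-idea-10 g9), stub L3 `Extraction`, part 2: ROBUST TESTS AND THE LIMIT OF THE LOCAL GAIN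

`--supports stmt-NavierStokesRegularity-26567` (helper; prover seat ns-net-p2 g11).  Two facts that let robust local maximality
pass to zoom limits (texts of record `…LocalMaximiserDefs`, `…LocalMaximiserLimitDefs`):
* `isTestAt_of_isTestIn` — a ROBUST test of `V` with margin `θ` (`IsTestIn V θ φ`: pointwise slack `‖V+φ‖ ≤ 1−θ` or inward
  `‖φ‖² + 2⟪V,φ⟫ ≤ −θ‖φ‖`) is an admissible height-1 test (`IsTestAt V' 1 φ`) of EVERY field `V'` of height `≤ 1` that is
  `θ/2`-close to `V` on `tsupport φ`;
* `tendsto_locGain_of_bounds` — along a smooth family `Vₙ → V` converging pointwise with all derivatives bounded uniformly,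
  `locGain κ μ Vₙ φ → locGain κ μ V φ` for every smooth compactly supported `φ`: Landau interpolation
  (`Calculus.tendsto_iteratedFDeriv_of_tendsto`) upgrades the convergence to every derivative, hence to `D`, `curl`, `D curl`
  and the three densities, and dominated convergence on `tsupport φ` does the rest.
Elementary; nothing about Navier–Stokes is used; no summit is proved by a line. [folklore]
-/

noncomputable section

open scoped Topology InnerProductSpace RealInnerProductSpace ENNReal ContDiff
open MeasureTheory Filter Set Metric Function
open Literature.Analysis Literature.Analysis.FluidPDE
open Summit.NavierStokesRegularity.NavierStokesRegularity.Theorems.DepletionLadder.KStar.HalfSpace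
open Summit.NavierStokesRegularity.NavierStokesRegularity.Theorems.DepletionLadder.KStar.BangBang

namespace Summit.NavierStokesRegularity.NavierStokesRegularity.Theorems

-- the problem directory repeats the summit name (`NavierStokesRegularity/NavierStokesRegularity`)
set_option linter.dupNamespace false

namespace NearExtremalTransiencePerFlow.LocalMaximiser

section Robust

variable {V V' φ : EuclideanSpace ℝ (Fin 3) → EuclideanSpace ℝ (Fin 3)} {θ : ℝ}

/-- **Robust tests are admissible for every nearby field of height `≤ 1`.** -/
theorem isTestAt_of_isTestIn (hθ : 0 < θ) (h : IsTestIn V θ φ) (hV' : ∀ x, ‖V' x‖ ≤ 1)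
    (hclose : ∀ x ∈ tsupport φ, ‖V' x - V x‖ ≤ θ / 2) : IsTestAt V' 1 φ := by
  obtain ⟨hs, hc, hdiv, hrob⟩ := h
  refine ⟨hs, hc, hdiv, fun x hx => ?_⟩
  have hd := hclose x hx
  rcases hrob x with hsl | hin
  · -- slack
    calc ‖V' x + φ x‖ = ‖(V x + φ x) + (V' x - V x)‖ := by congr 1; abel
      _ ≤ ‖V x + φ x‖ + ‖V' x - V x‖ := norm_add_le _ _
      _ ≤ (1 - θ) + θ / 2 := add_le_add hsl hd
      _ ≤ 1 := by linarith
  · -- inward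
    have h1 : ‖V' x + φ x‖ ^ 2 = ‖V' x‖ ^ 2 + 2 * ⟪V' x, φ x⟫_ℝ + ‖φ x‖ ^ 2 := norm_add_sq_real _ _
    have h2 : ⟪V' x, φ x⟫_ℝ = ⟪V x, φ x⟫_ℝ + ⟪V' x - V x, φ x⟫_ℝ := by
      rw [← inner_add_left]; congr 1; abel
    have h3 : ⟪V' x - V x, φ x⟫_ℝ ≤ θ / 2 * ‖φ x‖ :=
      (real_inner_le_norm _ _).trans (mul_le_mul_of_nonneg_right hd (norm_nonneg _))
    have h4 : ‖V' x + φ x‖ ^ 2 ≤ ‖V' x‖ ^ 2 := by nlinarith [norm_nonneg (φ x)]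
    have h5 : ‖V' x + φ x‖ ≤ ‖V' x‖ := by
      nlinarith [norm_nonneg (V' x + φ x), norm_nonneg (V' x)]
    exact h5.trans (hV' x)

end Robust

section GainLimit

open Literature.Analysis.Calculus

variable {Fn : ℕ → EuclideanSpace ℝ (Fin 3) → EuclideanSpace ℝ (Fin 3)} {F : EuclideanSpace ℝ (Fin 3) → EuclideanSpace ℝ (Fin 3)}

/-- Joint continuity of evaluation `(L, v) ↦ L v` along a filter. -/
theorem tendsto_clm_apply {α : Type*} {l : Filter α} {f : α → EuclideanSpace ℝ (Fin 3) →L[ℝ] EuclideanSpace ℝ (Fin 3)}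
    {g : α → EuclideanSpace ℝ (Fin 3)} {L : EuclideanSpace ℝ (Fin 3) →L[ℝ] EuclideanSpace ℝ (Fin 3)} {v : EuclideanSpace ℝ (Fin 3)}
    (hf : Tendsto f l (𝓝 L)) (hg : Tendsto g l (𝓝 v)) : Tendsto (fun a => f a (g a)) l (𝓝 (L v)) :=
  ((isBoundedBilinearMap_apply (𝕜 := ℝ) (E := EuclideanSpace ℝ (Fin 3)) (F := EuclideanSpace ℝ (Fin 3))).continuous.tendsto
    (L, v)).comp (hf.prodMk_nhds hg)

/-- **Every derivative converges pointwise** along a smooth family with uniformly bounded derivatives of all orders converging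
pointwise to a smooth limit with bounded derivatives (Landau interpolation, `Calculus.tendsto_iteratedFDeriv_of_tendsto`). -/
theorem tendsto_iteratedFDeriv_of_bounds (hFn : ∀ n, ContDiff ℝ (⊤ : ℕ∞) (Fn n)) (hF : ContDiff ℝ (⊤ : ℕ∞) F)
    (hb : ∀ k : ℕ, ∃ C : ℝ, (∀ n x, ‖iteratedFDeriv ℝ k (Fn n) x‖ ≤ C) ∧ ∀ x, ‖iteratedFDeriv ℝ k F x‖ ≤ C)
    (hpt : ∀ x, Tendsto (fun n => Fn n x) atTop (𝓝 (F x))) (k : ℕ) (x : EuclideanSpace ℝ (Fin 3)) :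
    Tendsto (fun n => iteratedFDeriv ℝ k (Fn n) x) atTop (𝓝 (iteratedFDeriv ℝ k F x)) := by
  refine tendsto_iteratedFDeriv_of_tendsto (l := atTop) (K := Fn) (K₀ := F) hFn hF (p := x) (R := 1) one_pos
    (fun j => ?_) (fun y _ => hpt y) k
  obtain ⟨C, hC, hC₀⟩ := hb j
  exact ⟨C, ⟨Eventually.of_forall fun n y _ => hC n y, fun y _ => hC₀ y⟩⟩

/-- Pointwise convergence of the gradients. -/
theorem tendsto_fderiv_of_bounds (hFn : ∀ n, ContDiff ℝ (⊤ : ℕ∞) (Fn n)) (hF : ContDiff ℝ (⊤ : ℕ∞) F)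
    (hb : ∀ k : ℕ, ∃ C : ℝ, (∀ n x, ‖iteratedFDeriv ℝ k (Fn n) x‖ ≤ C) ∧ ∀ x, ‖iteratedFDeriv ℝ k F x‖ ≤ C)
    (hpt : ∀ x, Tendsto (fun n => Fn n x) atTop (𝓝 (F x))) (x : EuclideanSpace ℝ (Fin 3)) :
    Tendsto (fun n => fderiv ℝ (Fn n) x) atTop (𝓝 (fderiv ℝ F x)) := by
  have h1 := tendsto_iteratedFDeriv_of_bounds hFn hF hb hpt 1 x
  rw [tendsto_iff_norm_sub_tendsto_zero] at h1 ⊢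
  refine h1.congr fun n => ?_
  have hd1 : ContDiffAt ℝ 1 (Fn n) x := ((hFn n).of_le (by norm_cast)).contDiffAt
  have hd2 : ContDiffAt ℝ 1 F x := (hF.of_le (by norm_cast)).contDiffAt
  rw [← iteratedFDeriv_sub_apply hd1 hd2, norm_iteratedFDeriv_one,
    fderiv_sub ((hFn n).differentiable (by simp) x) (hF.differentiable (by simp) x)]

/-- Pointwise convergence of the vorticities. -/
theorem tendsto_curl_of_bounds (hFn : ∀ n, ContDiff ℝ (⊤ : ℕ∞) (Fn n)) (hF : ContDiff ℝ (⊤ : ℕ∞) F)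
    (hb : ∀ k : ℕ, ∃ C : ℝ, (∀ n x, ‖iteratedFDeriv ℝ k (Fn n) x‖ ≤ C) ∧ ∀ x, ‖iteratedFDeriv ℝ k F x‖ ≤ C)
    (hpt : ∀ x, Tendsto (fun n => Fn n x) atTop (𝓝 (F x))) (x : EuclideanSpace ℝ (Fin 3)) :
    Tendsto (fun n => curl (Fn n) x) atTop (𝓝 (curl F x)) := by
  have h := tendsto_fderiv_of_bounds hFn hF hb hpt x
  simp_rw [curl_eq_curlCLM]
  exact (curlCLM.continuous.tendsto _).comp h

/-- The vorticity family inherits smoothness, bounds and pointwise convergence. -/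
theorem curl_family_bounds (hFn : ∀ n, ContDiff ℝ (⊤ : ℕ∞) (Fn n)) (hF : ContDiff ℝ (⊤ : ℕ∞) F)
    (hb : ∀ k : ℕ, ∃ C : ℝ, (∀ n x, ‖iteratedFDeriv ℝ k (Fn n) x‖ ≤ C) ∧ ∀ x, ‖iteratedFDeriv ℝ k F x‖ ≤ C) (k : ℕ) :
    ∃ C : ℝ, (∀ n x, ‖iteratedFDeriv ℝ k (curl (Fn n)) x‖ ≤ C) ∧ ∀ x, ‖iteratedFDeriv ℝ k (curl F) x‖ ≤ C := by
  obtain ⟨C, hC, hC₀⟩ := hb (k + 1)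
  refine ⟨4 * C, fun n x => ?_, fun x => ?_⟩
  · exact (norm_iteratedFDeriv_curl_le_four_mul (hFn n) k x).trans (by linarith [hC n x])
  · exact (norm_iteratedFDeriv_curl_le_four_mul hF k x).trans (by linarith [hC₀ x])

/-- Pointwise convergence of the vorticity gradients. -/
theorem tendsto_fderiv_curl_of_bounds (hFn : ∀ n, ContDiff ℝ (⊤ : ℕ∞) (Fn n)) (hF : ContDiff ℝ (⊤ : ℕ∞) F)
    (hb : ∀ k : ℕ, ∃ C : ℝ, (∀ n x, ‖iteratedFDeriv ℝ k (Fn n) x‖ ≤ C) ∧ ∀ x, ‖iteratedFDeriv ℝ k F x‖ ≤ C)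
    (hpt : ∀ x, Tendsto (fun n => Fn n x) atTop (𝓝 (F x))) (x : EuclideanSpace ℝ (Fin 3)) :
    Tendsto (fun n => fderiv ℝ (curl (Fn n)) x) atTop (𝓝 (fderiv ℝ (curl F) x)) :=
  tendsto_fderiv_of_bounds (Fn := fun n => curl (Fn n)) (F := curl F) (fun n => contDiff_curl (n := ⊤) (hFn n))
    (contDiff_curl (n := ⊤) hF) (curl_family_bounds hFn hF hb) (tendsto_curl_of_bounds hFn hF hb hpt) x

/-- Pointwise convergence of the three densities. -/
theorem tendsto_sd_zd_wd_of_bounds (hFn : ∀ n, ContDiff ℝ (⊤ : ℕ∞) (Fn n)) (hF : ContDiff ℝ (⊤ : ℕ∞) F)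
    (hb : ∀ k : ℕ, ∃ C : ℝ, (∀ n x, ‖iteratedFDeriv ℝ k (Fn n) x‖ ≤ C) ∧ ∀ x, ‖iteratedFDeriv ℝ k F x‖ ≤ C)
    (hpt : ∀ x, Tendsto (fun n => Fn n x) atTop (𝓝 (F x))) (x : EuclideanSpace ℝ (Fin 3)) :
    Tendsto (fun n => sd (Fn n) x) atTop (𝓝 (sd F x)) ∧ Tendsto (fun n => zd (Fn n) x) atTop (𝓝 (zd F x)) ∧
      Tendsto (fun n => wd (Fn n) x) atTop (𝓝 (wd F x)) := by
  have hc := tendsto_curl_of_bounds hFn hF hb hpt x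
  have hd := tendsto_fderiv_of_bounds hFn hF hb hpt x
  have hdc := tendsto_fderiv_curl_of_bounds hFn hF hb hpt x
  refine ⟨?_, ?_, ?_⟩
  · exact hc.inner (tendsto_clm_apply hd hc)
  · exact (hc.norm).pow 2
  · exact (continuous_frobeniusNormSq'.tendsto _).comp hdc

/-- Crude pointwise bounds for the three densities from gradient / Hessian bounds. -/
theorem sd_zd_wd_bounds {W : EuclideanSpace ℝ (Fin 3) → EuclideanSpace ℝ (Fin 3)} (hW : ContDiff ℝ (⊤ : ℕ∞) W) {B₁ B₂ : ℝ}
    (h1 : ∀ x, ‖iteratedFDeriv ℝ 1 W x‖ ≤ B₁) (h2 : ∀ x, ‖iteratedFDeriv ℝ 2 W x‖ ≤ B₂) (x : EuclideanSpace ℝ (Fin 3)) :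
    |sd W x| ≤ 16 * B₁ ^ 3 ∧ zd W x ≤ 16 * B₁ ^ 2 ∧ wd W x ≤ 48 * B₂ ^ 2 := by
  have hB₁ : 0 ≤ B₁ := (norm_nonneg _).trans (h1 x)
  have hD : ‖fderiv ℝ W x‖ ≤ B₁ := by rw [← norm_iteratedFDeriv_one]; exact h1 x
  have hω : ‖curl W x‖ ≤ 4 * B₁ := (norm_curl_le_four_mul W x).trans (by linarith)
  have hDω : ‖fderiv ℝ (curl W) x‖ ≤ 4 * B₂ := by
    rw [← norm_iteratedFDeriv_one]
    exact norm_iteratedFDeriv_curl_le_four_mul hW 1 x |>.trans (by linarith [h2 x])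
  refine ⟨?_, ?_, ?_⟩
  · unfold sd
    calc |⟪curl W x, fderiv ℝ W x (curl W x)⟫_ℝ| ≤ ‖curl W x‖ * ‖fderiv ℝ W x (curl W x)‖ := abs_real_inner_le_norm _ _
      _ ≤ ‖curl W x‖ * (‖fderiv ℝ W x‖ * ‖curl W x‖) :=
          mul_le_mul_of_nonneg_left (ContinuousLinearMap.le_opNorm _ _) (norm_nonneg _)
      _ ≤ (4 * B₁) * (B₁ * (4 * B₁)) := by gcongr
      _ = 16 * B₁ ^ 3 := by ring
  · unfold zd
    calc ‖curl W x‖ ^ 2 ≤ (4 * B₁) ^ 2 := pow_le_pow_left₀ (norm_nonneg _) hω 2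
      _ = 16 * B₁ ^ 2 := by ring
  · unfold wd
    calc frobeniusNormSq (fderiv ℝ (curl W) x) ≤ 3 * ‖fderiv ℝ (curl W) x‖ ^ 2 := frobeniusNormSq_le_three_mul _
      _ ≤ 3 * (4 * B₂) ^ 2 := by gcongr
      _ = 48 * B₂ ^ 2 := by ring

/-! ### Locality of the gain integrand and dominated convergence -/

variable {κ μ : ℝ}

/-- The stretching density is local. -/
theorem sd_congr_nhds {V₁ V₂ : EuclideanSpace ℝ (Fin 3) → EuclideanSpace ℝ (Fin 3)} {x : EuclideanSpace ℝ (Fin 3)}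
    (h : V₁ =ᶠ[𝓝 x] V₂) : sd V₁ x = sd V₂ x := by
  -- (`curl` is local: cf. `FluidComputer.SelfSimilarCensus.curl_congr_of_eventuallyEq`, not imported here)
  have hc : curl V₁ x = curl V₂ x := by simp only [curl, h.fderiv_eq]
  unfold sd; rw [hc, h.fderiv_eq]

/-- The enstrophy density is local. -/
theorem zd_congr_nhds {V₁ V₂ : EuclideanSpace ℝ (Fin 3) → EuclideanSpace ℝ (Fin 3)} {x : EuclideanSpace ℝ (Fin 3)}
    (h : V₁ =ᶠ[𝓝 x] V₂) : zd V₁ x = zd V₂ x := by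
  have hc : curl V₁ x = curl V₂ x := by simp only [curl, h.fderiv_eq]
  unfold zd; rw [hc]

/-- The palinstrophy density is local. -/
theorem wd_congr_nhds {V₁ V₂ : EuclideanSpace ℝ (Fin 3) → EuclideanSpace ℝ (Fin 3)} {x : EuclideanSpace ℝ (Fin 3)}
    (h : V₁ =ᶠ[𝓝 x] V₂) : wd V₁ x = wd V₂ x := by
  have h' : curl V₁ =ᶠ[𝓝 x] curl V₂ := h.eventuallyEq_nhds.mono fun _ hy => by simp only [curl, hy.fderiv_eq]
  unfold wd; rw [h'.fderiv_eq]

/-- The gain integrand. -/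
def gainIntegrand (κ μ : ℝ) (V φ : EuclideanSpace ℝ (Fin 3) → EuclideanSpace ℝ (Fin 3)) (x : EuclideanSpace ℝ (Fin 3)) : ℝ :=
  (sd (V + φ) x - sd V x) - (κ / 2) * (μ⁻¹ * (zd (V + φ) x - zd V x) + μ * (wd (V + φ) x - wd V x))

/-- `locGain` is the integral of `gainIntegrand` (definitional). -/
theorem locGain_eq_integral (κ μ : ℝ) (V φ : EuclideanSpace ℝ (Fin 3) → EuclideanSpace ℝ (Fin 3)) :
    locGain κ μ V φ = ∫ x, gainIntegrand κ μ V φ x := rfl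

/-- The gain integrand vanishes off `tsupport φ`. -/
theorem gainIntegrand_eq_zero {V φ : EuclideanSpace ℝ (Fin 3) → EuclideanSpace ℝ (Fin 3)} {x : EuclideanSpace ℝ (Fin 3)}
    (hx : x ∉ tsupport φ) : gainIntegrand κ μ V φ x = 0 := by
  have h : (V + φ) =ᶠ[𝓝 x] V :=
    (notMem_tsupport_iff_eventuallyEq.1 hx).mono fun y hy => by simp only [Pi.add_apply, hy, Pi.zero_apply, add_zero]
  unfold gainIntegrand
  rw [sd_congr_nhds h, zd_congr_nhds h, wd_congr_nhds h]; ring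

/-- The stretching density of a smooth field is continuous. -/
theorem continuous_sd' {V : EuclideanSpace ℝ (Fin 3) → EuclideanSpace ℝ (Fin 3)} (hV : ContDiff ℝ (⊤ : ℕ∞) V) :
    Continuous (sd V) := by
  have cω : Continuous (curl V) := continuous_curl (hV.of_le (by norm_cast))
  unfold sd
  exact cω.inner ((hV.continuous_fderiv (by simp)).clm_apply cω)

/-- The enstrophy density of a smooth field is continuous. -/
theorem continuous_zd' {V : EuclideanSpace ℝ (Fin 3) → EuclideanSpace ℝ (Fin 3)} (hV : ContDiff ℝ (⊤ : ℕ∞) V) :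
    Continuous (zd V) := by
  have cω : Continuous (curl V) := continuous_curl (hV.of_le (by norm_cast))
  unfold zd
  exact (cω.norm).pow 2

/-- The palinstrophy density of a smooth field is continuous. -/
theorem continuous_wd' {V : EuclideanSpace ℝ (Fin 3) → EuclideanSpace ℝ (Fin 3)} (hV : ContDiff ℝ (⊤ : ℕ∞) V) :
    Continuous (wd V) := by
  have hω : ContDiff ℝ (⊤ : ℕ∞) (curl V) := contDiff_curl (n := ⊤) hV
  unfold wd
  exact continuous_frobeniusNormSq'.comp (hω.continuous_fderiv (by simp))

/-- The gain integrand of smooth data is continuous. -/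
theorem continuous_gainIntegrand {V φ : EuclideanSpace ℝ (Fin 3) → EuclideanSpace ℝ (Fin 3)} (hV : ContDiff ℝ (⊤ : ℕ∞) V)
    (hφ : ContDiff ℝ (⊤ : ℕ∞) φ) : Continuous (gainIntegrand κ μ V φ) := by
  have hVφ : ContDiff ℝ (⊤ : ℕ∞) (V + φ) := hV.add hφ
  unfold gainIntegrand
  exact ((continuous_sd' hVφ).sub (continuous_sd' hV)).sub
    (continuous_const.mul ((continuous_const.mul ((continuous_zd' hVφ).sub (continuous_zd' hV))).add
      (continuous_const.mul ((continuous_wd' hVφ).sub (continuous_wd' hV)))))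

/-- Bounds of all derivatives of a smooth compactly supported field. -/
theorem exists_bounds_of_hasCompactSupport {φ : EuclideanSpace ℝ (Fin 3) → EuclideanSpace ℝ (Fin 3)}
    (hφ : ContDiff ℝ (⊤ : ℕ∞) φ) (hφc : HasCompactSupport φ) (k : ℕ) : ∃ C : ℝ, ∀ x, ‖iteratedFDeriv ℝ k φ x‖ ≤ C :=
  (hφc.iteratedFDeriv (𝕜 := ℝ) k).exists_bound_of_continuous (hφ.continuous_iteratedFDeriv (by exact_mod_cast le_top))

/-- **Continuity of the local gain along bounded pointwise-convergent smooth families** (dominated convergence on `tsupport φ`,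
with pointwise convergence of `V, DV, curl V, D curl V` from Landau interpolation). -/
theorem tendsto_locGain_of_bounds (κ μ : ℝ) (hFn : ∀ n, ContDiff ℝ (⊤ : ℕ∞) (Fn n)) (hF : ContDiff ℝ (⊤ : ℕ∞) F)
    (hb : ∀ k : ℕ, ∃ C : ℝ, (∀ n x, ‖iteratedFDeriv ℝ k (Fn n) x‖ ≤ C) ∧ ∀ x, ‖iteratedFDeriv ℝ k F x‖ ≤ C)
    (hpt : ∀ x, Tendsto (fun n => Fn n x) atTop (𝓝 (F x)))
    {φ : EuclideanSpace ℝ (Fin 3) → EuclideanSpace ℝ (Fin 3)} (hφ : ContDiff ℝ (⊤ : ℕ∞) φ) (hφc : HasCompactSupport φ) :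
    Tendsto (fun n => locGain κ μ (Fn n) φ) atTop (𝓝 (locGain κ μ F φ)) := by
  -- the shifted family `Fn n + φ → F + φ`
  have hGn : ∀ n, ContDiff ℝ (⊤ : ℕ∞) (Fn n + φ) := fun n => (hFn n).add hφ
  have hG : ContDiff ℝ (⊤ : ℕ∞) (F + φ) := hF.add hφ
  have hbG : ∀ k : ℕ, ∃ C : ℝ, (∀ n x, ‖iteratedFDeriv ℝ k (Fn n + φ) x‖ ≤ C) ∧ ∀ x, ‖iteratedFDeriv ℝ k (F + φ) x‖ ≤ C := by
    intro k
    obtain ⟨C, hC, hC₀⟩ := hb k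
    obtain ⟨Cφ, hCφ⟩ := exists_bounds_of_hasCompactSupport hφ hφc k
    have hk : ∀ {f : EuclideanSpace ℝ (Fin 3) → EuclideanSpace ℝ (Fin 3)}, ContDiff ℝ (⊤ : ℕ∞) f → ∀ x, ContDiffAt ℝ k f x :=
      fun hf x => (hf.of_le (by exact_mod_cast le_top)).contDiffAt
    refine ⟨C + Cφ, fun n x => ?_, fun x => ?_⟩
    · rw [iteratedFDeriv_add_apply (hk (hFn n) x) (hk hφ x)]
      exact (norm_add_le _ _).trans (add_le_add (hC n x) (hCφ x))
    · rw [iteratedFDeriv_add_apply (hk hF x) (hk hφ x)]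
      exact (norm_add_le _ _).trans (add_le_add (hC₀ x) (hCφ x))
  have hptG : ∀ x, Tendsto (fun n => (Fn n + φ) x) atTop (𝓝 ((F + φ) x)) := fun x => by
    simpa only [Pi.add_apply] using (hpt x).add_const (φ x)
  -- pointwise convergence of the integrand
  have hlim : ∀ x, Tendsto (fun n => gainIntegrand κ μ (Fn n) φ x) atTop (𝓝 (gainIntegrand κ μ F φ x)) := by
    intro x
    obtain ⟨h1, h2, h3⟩ := tendsto_sd_zd_wd_of_bounds hGn hG hbG hptG x
    obtain ⟨h1', h2', h3'⟩ := tendsto_sd_zd_wd_of_bounds hFn hF hb hpt x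
    unfold gainIntegrand
    exact (h1.sub h1').sub ((((h2.sub h2').const_mul _).add ((h3.sub h3').const_mul _)).const_mul _)
  -- the dominating constant
  obtain ⟨C₁, hC₁, hC₁'⟩ := hbG 1
  obtain ⟨C₂, hC₂, hC₂'⟩ := hbG 2
  obtain ⟨D₁, hD₁, hD₁'⟩ := hb 1
  obtain ⟨D₂, hD₂, hD₂'⟩ := hb 2
  set K : ℝ := (16 * C₁ ^ 3 + 16 * D₁ ^ 3) +
    |κ / 2| * (|μ⁻¹| * (16 * C₁ ^ 2 + 16 * D₁ ^ 2) + |μ| * (48 * C₂ ^ 2 + 48 * D₂ ^ 2)) with hK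
  have hbound : ∀ n x, ‖gainIntegrand κ μ (Fn n) φ x‖ ≤ (tsupport φ).indicator (fun _ => K) x := by
    intro n x
    by_cases hx : x ∈ tsupport φ
    · rw [Set.indicator_of_mem hx, Real.norm_eq_abs]
      obtain ⟨a1, a2, a3⟩ := sd_zd_wd_bounds (hGn n) (hC₁ n) (hC₂ n) x
      obtain ⟨b1, b2, b3⟩ := sd_zd_wd_bounds (hFn n) (hD₁ n) (hD₂ n) x
      have hz1 : 0 ≤ zd (Fn n + φ) x := sq_nonneg _
      have hz2 : 0 ≤ zd (Fn n) x := sq_nonneg _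
      have hw1 : 0 ≤ wd (Fn n + φ) x := frobeniusNormSq_nonneg _
      have hw2 : 0 ≤ wd (Fn n) x := frobeniusNormSq_nonneg _
      unfold gainIntegrand
      calc |sd (Fn n + φ) x - sd (Fn n) x -
              κ / 2 * (μ⁻¹ * (zd (Fn n + φ) x - zd (Fn n) x) + μ * (wd (Fn n + φ) x - wd (Fn n) x))|
          ≤ |sd (Fn n + φ) x - sd (Fn n) x| +
              |κ / 2 * (μ⁻¹ * (zd (Fn n + φ) x - zd (Fn n) x) + μ * (wd (Fn n + φ) x - wd (Fn n) x))| := abs_sub _ _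
        _ ≤ (|sd (Fn n + φ) x| + |sd (Fn n) x|) +
              |κ / 2| * (|μ⁻¹| * |zd (Fn n + φ) x - zd (Fn n) x| + |μ| * |wd (Fn n + φ) x - wd (Fn n) x|) := by
            gcongr
            · exact abs_sub _ _
            · rw [abs_mul]
              gcongr
              refine (abs_add_le _ _).trans ?_
              rw [abs_mul, abs_mul]
        _ ≤ K := by
            rw [hK]
            have e1 : |zd (Fn n + φ) x - zd (Fn n) x| ≤ 16 * C₁ ^ 2 + 16 * D₁ ^ 2 := by
              rw [abs_le]; constructor <;> linarith
            have e2 : |wd (Fn n + φ) x - wd (Fn n) x| ≤ 48 * C₂ ^ 2 + 48 * D₂ ^ 2 := by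
              rw [abs_le]; constructor <;> linarith
            gcongr
    · rw [Set.indicator_of_notMem hx, gainIntegrand_eq_zero hx, norm_zero]
  have hKint : Integrable ((tsupport φ).indicator fun _ : EuclideanSpace ℝ (Fin 3) => K) volume := by
    rw [integrable_indicator_iff (isClosed_tsupport φ).measurableSet]
    exact integrableOn_const (hs := hφc.measure_lt_top.ne)
  rw [locGain_eq_integral]
  simp_rw [locGain_eq_integral]
  exact tendsto_integral_of_dominated_convergence _ (fun n => (continuous_gainIntegrand (hFn n) hφ).aestronglyMeasurable) hKint
    (fun n => Eventually.of_forall (hbound n)) (Eventually.of_forall hlim)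

end GainLimit

end NearExtremalTransiencePerFlow.LocalMaximiser

end Summit.NavierStokesRegularity.NavierStokesRegularity.Theorems

end
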